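import Literature.AlgebraicGeometry.Modules.CohomologyFlatBaseChange
import Literature.AlgebraicGeometry.Morphisms.SectionsRankOfFibreVanishing
import Literature.AlgebraicGeometry.Motives.CartierDivisorLineBundleSectionsOn
import Literature.AlgebraicGeometry.Motives.CartierDivisorPullbackLineBundleIso
import Literature.AlgebraicGeometry.Motives.AbelianVarietyKThetaCardFieldChange
import Literature.AlgebraicGeometry.Motives.AbelianVarietyFGSubfieldDescentDivisor
import Literature.AlgebraicGeometry.Motives.CartierDivisorAmpleSpread
import Literature.AlgebraicGeometry.Motives.AbelianVarietyBaseChangeTowerFst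
import Literature.FieldTheory.AlgClosed.EmbeddingIntoComplex
import Literature.AlgebraicGeometry.HodgeTheory.AbelianVarietyH0SqEqCardKTheta
import Mathlib.FieldTheory.AlgebraicClosure
import HarnessLib

/-!
# `h⁰(A, 𝒪(Θ))² = #K(Θ)` for an ample divisor on an abelian variety over ANY algebraically closed field of characteristic `0`,
# by transport from `ℂ` ([MumfordAV1970] §16; the (L3) descent device)

Layer `Literature/AlgebraicGeometry/Motives`, namespaces `Literature.AlgebraicGeometry.Motives.CartierDivisor` (§1–§2) and
`…Motives.AbelianVariety` (§3–§4).  THEOREMS ONLY (no definition, no named fact, no instance, no notation, no `sorry`).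
Cell `hodgecm-mathlib` (D-0151), F-DAG F-2 (b) RANK brick (road (a) of record, B-plan1 (g16) 07:48:31Z; census
`B-provers/B-p05/g17/CENSUS-F2b-Rank.B-p05g17.md`): leaf (R3) «transport `ℂ ⇝ Ω`» (B-p11 (g17)), file 2/3 (file 1 = ★
`Motives/AbelianVarietyKThetaCardFieldChange`, the `#K(Θ)` half; file 3 = the `hrank` consumer form at the fibres of `L^Δ(λ)`).
The ℂ-brick «`dim_ℂ Γ(A, 𝒪(Θ))² = #K(Θ)`» ([MumfordAV1970] §16 Riemann–Roch + vanishing; over `ℂ`: theta functions ★ (R2-an)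
`HodgeTheory/AbelianVarietyAnalyticH0SqEqCardKTheta` + GAGA ★ (R1) `HodgeTheory/GAGASectionsOfLineBundle`, assembled by B-p05 (g17) as
(R2) `HodgeTheory/AbelianVarietyH0SqEqCardKTheta.finrank_sections_sq_eq_natCard_KTheta`) enters §4 as the HYPOTHESIS `hℂ` in its exact
shape (the transport is independent of the analysis), and §5 plugs the ★ head BY NAME: the UNCONDITIONAL forms
`…_of_isAlgClosed`.
HC_CM is proved only modulo the 7 printed citations until rung 0 closes; nothing here bears on a summit statement.

* §1 **`CartierDivisor.finrank_secMod_lineBundle_eq_h0`** — the BRIDGE between the two section currencies: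
  `dim_K Γ(Y, lineBundle 𝒪_Y(D)) = h⁰(D)` (`SecMod` of the glued line bundle through `K → Γ(Y, 𝒪_Y)` versus ★ `CartierDivisor.h0` =
  `dim_K {s ∈ K(Y) ; f_i s regular on U_i}`; the canonical bijection ★ `lineBundleSectionsOnEquiv` is `K`-linear).
* §2 **`CartierDivisor.h0_pullback_eq_of_isPullback_specMap`** — `h⁰(q^*D) = h⁰(D)` along ANY cartesian square `Y' → Y` over a
  field map `Spec L → Spec K` (`Y` proper integral): flat base change of `H⁰` ★ `Modules.finrank_secMod_top_eq_of_isPullback_specMap'`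
  ([GortzWedhorn2023] Cor. 22.91) + `q^*𝒪(D) ≅ 𝒪(q^*D)` ★ `CartierDivisor.pullbackLineBundleIso` + §1.
* §3 `AbelianVariety.h0_pullback_baseChangeFst_eq` (`h⁰(Θ ⊗ L) = h⁰(Θ)` for `B_L = B.baseChange L`), `AbelianVariety.h0_pullback_iso_eq`
  (`h⁰(e^*Θ) = h⁰(Θ)` for an isomorphism `e` of abelian varieties).
* §5 **`AbelianVariety.h0_sq_eq_natCard_KTheta_of_isAlgClosed (X : AbelianVariety Ω) (Θ) (hΘ : Θ.IsAmple) : Θ.h0 Ω ^ 2 = Nat.card (X.KTheta Θ)`**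
  for EVERY algebraically closed `Ω` of characteristic `0` — UNCONDITIONAL (§4 + ★ (R2) `finrank_sections_sq_eq_natCard_KTheta`), with the
  `finrank_sections_…` and `finrank_secMod_lineBundle_…` spellings.
* §4 HEAD **`AbelianVariety.h0_sq_eq_natCard_KTheta_of_complex (hℂ) {Ω} [IsAlgClosed Ω] [CharZero Ω] (X : AbelianVariety Ω) (Θ)
  (hΘ : Θ.IsAmple) : Θ.h0 Ω ^ 2 = Nat.card (X.KTheta Θ)`** (+ `finrank_sections_…`, `finrank_secMod_lineBundle_…` spellings).
  TRANSPORT = the device of ★ `AbelianSchemes/PolarizedTripleRigidityDescent` with numbers in place of automorphisms: descend `(X, Θ)`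
  to `k₁ = ℚ(s)` (★ F1 `exists_finset_intermediateField_descent_end_divisor`), spread the ampleness (★ F2
  `IsAmple.exists_finset_forall_isAmple_classPullback`), `K₂ :=` the algebraic closure of `k₁(s′)` in `Ω` (countable, algebraically
  closed), `σ : K₂ ↪ ℂ` (★ `nonempty_ringHom_complex_of_countable`); `h⁰` agrees over `Ω, k₁, K₂, ℂ` (§3) and `#K(Θ)` agrees over
  `Ω ⊇ K₂ ↪ ℂ` (★ `natCard_KTheta_baseChange_eq`, ★ `natCard_KTheta_pullback_iso`, ★ `KTheta_congr_linEquiv`, the tower ★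
  `baseChangeTowerIso` / `toSchemeHom_baseChangeTowerIso_hom_comp_fst`).

## References
* [MumfordAV1970] D. Mumford, *Abelian Varieties*, TIFR Studies in Mathematics 5 (1970), §16 (the Riemann–Roch theorem and the
  vanishing theorem), §6 Application 3 (p. 64).
* [GortzWedhorn2023] U. Görtz, T. Wedhorn, *Algebraic Geometry II: Cohomology of Schemes* (2023), Cor. 22.91 (p. 278).
* [GortzWedhorn2020] U. Görtz, T. Wedhorn, *Algebraic Geometry I: Schemes*, 2nd ed. (2020), Section (11.9) (p. 301), Rem. 11.16
  (p. 298), Prop. 11.50 (b).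
-/

noncomputable section

set_option backward.isDefEq.respectTransparency false

open CategoryTheory CategoryTheory.Limits AlgebraicGeometry Opposite TopologicalSpace

namespace Literature.AlgebraicGeometry.Motives

namespace CartierDivisor

open Literature.AlgebraicGeometry.Modules Literature.AlgebraicGeometry.Morphisms RatFn

/-! ## §1 `dim_K Γ(Y, lineBundle 𝒪(D)) = h⁰(D)`: the glued line bundle and the subsheaf `𝒪_Y(D) ⊆ 𝒦_Y` have the same global sections -/

section Bridge

variable {K : Type} [Field K] (Y : Over (Spec (.of K))) [IsIntegral Y.left] (D : CartierDivisor Y.left)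

/-- **`dim_K Γ(Y, lineBundle 𝒪_Y(D)) = h⁰(D)`**: the global sections of the GLUED line bundle `Modules.lineBundle D.toUnitCocycle`, as a
`K`-vector space through `K → Γ(Y, 𝒪_Y)` (the `SecMod` currency of the cohomology-and-base-change files), have dimension
`h⁰(D) = dim_K {s ∈ K(Y) ; f_i s ∈ Γ(U_i, 𝒪_Y)}` (★ `CartierDivisor.h0`) — the canonical bijection ★ `lineBundleSectionsOnEquiv`
(Görtz–Wedhorn I, (11.9): `𝒪_Y(D)|_{U_i} = f_i⁻¹ 𝒪_{U_i}` is the module glued along `f_i/f_j`) is `K`-linear.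
[cite: GortzWedhorn2020, Section (11.9) (p. 301) and Rem. 11.16 (p. 298)] -/
theorem finrank_secMod_lineBundle_eq_h0 :
    Module.finrank K (SecMod (Modules.lineBundle D.toUnitCocycle)
        (Y.hom.appTop.hom.comp (Scheme.ΓSpecIso (.of K)).inv.hom) ⊤) = D.h0 K := by
  let ρ : K →+* Γ(Y.left, ⊤) := Y.hom.appTop.hom.comp (Scheme.ΓSpecIso (.of K)).inv.hom
  have hW : genericPoint Y.left ∈ (⊤ : Y.left.Opens) := trivial
  have hρ : ∀ a, ∀ x ∈ (⊤ : Y.left.Opens), IsRegularAt x (algebraMap K Y.left.functionField a) :=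
    fun a x _ => RatFn.isRegularAt_algebraMap x a
  let e := D.lineBundleSectionsOnEquiv hW hρ
  -- `SecMod` scalars: `a • s = ρ(a)|_⊤ • s`, and `ρ(a)|_⊤` has rational function `algebraMap K K(Y) a`
  have ht : ∀ a : K, (toSections ρ ⊤ a : Γ(Y.left, ⊤)) = ρ a := fun a => by
    change Y.left.presheaf.map (homOfLE le_top).op (ρ a) = ρ a
    rw [show (homOfLE (le_top : (⊤ : Y.left.Opens) ≤ ⊤)) = 𝟙 _ from Subsingleton.elim _ _, op_id, Y.left.presheaf.map_id]
    rfl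
  have hσ : ∀ a : K, ofSection hW (ρ a) = algebraMap K Y.left.functionField a := fun a => by
    rw [IsScalarTower.algebraMap_apply K (Y.left.presheaf.stalk (genericPoint Y.left)) Y.left.functionField a,
      RatFn.algebraMap_stalk_apply]
    rfl
  -- the two section spaces inside `K(Y)` coincide: `IsSectionOn ⊤ = IsSection`
  have hsec : ∀ s : Y.left.functionField, D.IsSectionOn (⊤ : Y.left.Opens) s ↔ D.IsSection s :=
    fun s => ⟨fun h i x hx => h i x hx trivial, fun h i x hx _ => h i x hx⟩
  let j : SecMod (Modules.lineBundle D.toUnitCocycle) ρ ⊤ ≃+ D.sections K :=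
    e.trans ⟨⟨fun s => ⟨s.1, (hsec s.1).1 s.2⟩, fun s => ⟨s.1, (hsec s.1).2 s.2⟩, fun _ => rfl, fun _ => rfl⟩, fun _ _ => rfl⟩
  have h := rank_eq_of_equiv_equiv (R := K) (R' := K) (M := SecMod (Modules.lineBundle D.toUnitCocycle) ρ ⊤)
    (M₁ := D.sections K) id j Function.bijective_id (fun a m => by
      apply Subtype.ext
      change (e (a • m) : Y.left.functionField) = a • (e m : Y.left.functionField)
      have hm : (a • m : SecMod (Modules.lineBundle D.toUnitCocycle) ρ ⊤) =
          SecMod.mk (ρ := ρ) ((ρ a) • SecMod.val (L := Modules.lineBundle D.toUnitCocycle) (ρ := ρ) m) := by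
        apply SecMod.val_injective (L := Modules.lineBundle D.toUnitCocycle) (ρ := ρ)
        rw [SecMod.smul_def, ht]; rfl
      rw [hm]
      change (e ((ρ a) • SecMod.val (L := Modules.lineBundle D.toUnitCocycle) (ρ := ρ) m) : Y.left.functionField) = _
      rw [D.coe_lineBundleSectionsOnEquiv_smul hW hρ, hσ, Algebra.smul_def]
      rfl)
  exact congrArg Cardinal.toNat h

end Bridge

/-! ## §2 `h⁰` is invariant under base change along a field map, in any cartesian presentation -/

section FieldChange

variable {K L : Type} [Field K] [Field L] (φ : K →+* L) {Y : Over (Spec (.of K))} {Y' : Over (Spec (.of L))}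
  [IsIntegral Y.left] [IsIntegral Y'.left] (q : Y'.left ⟶ Y.left) [IsDominant q]
  (H : IsPullback q Y'.hom Y.hom (Spec.map (CommRingCat.ofHom φ))) (D : CartierDivisor Y.left)

include H in
/-- **`h⁰(q^*D) = h⁰(D)` along ANY cartesian square over a field map `φ : K → L`** (`Y' = Y ×_K Spec L` in any presentation,
`q : Y' → Y` the dominant projection, `Y → Spec K` proper, `Y, Y'` integral): flat base change of `H⁰` (★
`Modules.finrank_secMod_top_eq_of_isPullback_specMap'`, Görtz–Wedhorn II Cor. 22.91), `q^*𝒪_Y(D) ≅ 𝒪_{Y'}(q^*D)` (★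
`CartierDivisor.pullbackLineBundleIso`) and §1 on both sides. [cite: GortzWedhorn2023, Cor. 22.91 (p. 278)]
[cite: GortzWedhorn2020, Prop. 11.50 (b)] -/
theorem h0_pullback_eq_of_isPullback_specMap [IsProper Y.hom] : (D.pullback q).h0 L = D.h0 K := by
  have hG : IsAffineLocalizing (Modules.lineBundle D.toUnitCocycle) := by
    haveI := D.toUnitCocycle.isFiniteLocallyFree_lineBundle.isVectorBundle.1
    exact IsAffineLocalizing.of_isQuasicoherent _
  have hbc := finrank_secMod_top_eq_of_isPullback_specMap' φ H (Modules.lineBundle D.toUnitCocycle) hG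
  obtain ⟨Lin, -⟩ := exists_secMod_linearEquiv_of_iso (Y'.hom.appTop.hom.comp (Scheme.ΓSpecIso (.of L)).inv.hom)
    (D.pullbackLineBundleIso q)
  rw [← finrank_secMod_lineBundle_eq_h0 Y D, ← finrank_secMod_lineBundle_eq_h0 Y' (D.pullback q), ← Lin.finrank_eq]
  exact hbc

end FieldChange

end CartierDivisor

namespace AbelianVariety

open Literature.AlgebraicGeometry.AbelianVarieties Literature.AlgebraicGeometry.AbelianVarieties.AbelianVariety
open Literature.AlgebraicGeometry.Modules

/-! ## §3 `h⁰` of an abelian variety along base change and along isomorphisms -/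

section AV

variable {k : Type} [Field k] (L : Type) [Field L] [Algebra k L] (B : AbelianVariety k) (Θ : CartierDivisor B.X.left)
  (π : (B.baseChange L).X.left ⟶ B.X.left) (hπ : π = pullback.fst B.X.hom (bcSpec k L))

include hπ in
/-- **`h⁰(Θ ⊗ L) = h⁰(Θ)`** for the base change `B_L` of an abelian variety along a field extension `L / k` and the pulled-back
divisor `π^*Θ` (§2 on the defining square of `B_L`). [cite: GortzWedhorn2023, Cor. 22.91 (p. 278)] -/
theorem h0_pullback_baseChangeFst_eq [IsDominant π] : (Θ.pullback π).h0 L = Θ.h0 k := by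
  haveI : IsProper B.X.hom := B.isProper
  subst hπ
  exact CartierDivisor.h0_pullback_eq_of_isPullback_specMap (algebraMap k L) (Y := B.X) (Y' := (B.baseChange L).X)
    (pullback.fst B.X.hom (bcSpec k L)) (IsPullback.of_hasPullback B.X.hom (bcSpec k L)) Θ

/-- **`h⁰(e^*Θ) = h⁰(Θ)` for an isomorphism `e : B′ ≅ B`** of abelian varieties (the square `(e, 𝟙)` is cartesian; §2 at `φ = id`).
[cite: GortzWedhorn2020, Prop. 11.50 (b)] -/
theorem h0_pullback_iso_eq {B' : AbelianVariety k} (e : B' ≅ B) (D : CartierDivisor B.X.left) :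
    haveI := isDominant_toSchemeHom_iso_hom e
    (D.pullback (Hom.toSchemeHom e.hom)).h0 k = D.h0 k := by
  haveI := isDominant_toSchemeHom_iso_hom e
  haveI : IsProper B.X.hom := B.isProper
  haveI : IsIso (Hom.toSchemeHom e.hom) :=
    ⟨Hom.toSchemeHom e.inv, by change Hom.toSchemeHom (e.hom ≫ e.inv) = _; rw [e.hom_inv_id]; rfl, by
      change Hom.toSchemeHom (e.inv ≫ e.hom) = _; rw [e.inv_hom_id]; rfl⟩
  have hid : Spec.map (CommRingCat.ofHom (RingHom.id k)) = 𝟙 _ := by rw [CommRingCat.ofHom_id, Spec.map_id]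
  haveI : IsIso (Spec.map (CommRingCat.ofHom (RingHom.id k))) := by rw [hid]; infer_instance
  have hw : Hom.toSchemeHom e.hom ≫ B.X.hom = B'.X.hom := Over.w e.hom.hom.hom.hom
  have hsq : IsPullback (Hom.toSchemeHom e.hom) B'.X.hom B.X.hom (Spec.map (CommRingCat.ofHom (RingHom.id k))) :=
    IsPullback.of_horiz_isIso ⟨by rw [hw, hid, Category.comp_id]⟩
  exact CartierDivisor.h0_pullback_eq_of_isPullback_specMap (RingHom.id k) (Y := B.X) (Y' := B'.X) _ hsq D

end AV

/-! ## §4 `h⁰(Θ)² = #K(Θ)` over EVERY algebraically closed field of characteristic `0`, from the identity over `ℂ` -/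

/-- **`h⁰(A, 𝒪(Θ))² = #K(Θ)` for `Θ` ample on an abelian variety over ANY algebraically closed field `Ω` of characteristic `0`**,
GIVEN the identity over `ℂ` (hypothesis `hℂ` in the exact shape of the ℂ-brick — [MumfordAV1970] §16 Riemann–Roch + vanishing,
over `ℂ` the theta-function count ★ `HodgeTheory/AbelianVarietyAnalyticH0SqEqCardKTheta` + GAGA ★ `HodgeTheory/GAGASectionsOfLineBundle`).
TRANSPORT (the (L3) device of ★ `PolarizedTripleRigidityDescent`, numbers instead of automorphisms): descend `(A, Θ)` to the finitely
generated field `k₁ = ℚ(s)` (★ F1 `exists_finset_intermediateField_descent_end_divisor`), spread the ampleness to a finite stage (★ F2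
`IsAmple.exists_finset_forall_isAmple_classPullback`), let `K₂ ⊆ Ω` be the algebraic closure of `k₁(s′)` in `Ω` (countable, algebraically
closed) and `σ : K₂ ↪ ℂ` (★ `nonempty_ringHom_complex_of_countable`); `h⁰` is the same over `Ω`, `k₁`, `K₂`, `ℂ` (§3, flat base change of
`H⁰`), and `#K(Θ)` is the same over `Ω ⊇ K₂ ↪ ℂ` (★ `natCard_KTheta_baseChange_eq`: `K(Θ)` of an ample class is finite, hence torsion,
hence rational over the algebraically closed `K₂`; ★ `natCard_KTheta_pullback_iso`, ★ `KTheta_congr_linEquiv`).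
[cite: MumfordAV1970, §16 (the Riemann–Roch theorem) and §6 Application 3 (p. 64)] [cite: GortzWedhorn2023, Cor. 22.91 (p. 278)] -/
theorem h0_sq_eq_natCard_KTheta_of_complex
    (hℂ : ∀ (B : AbelianVariety ℂ) (Θ : CartierDivisor B.X.left), Θ.IsAmple →
      Module.finrank ℂ (Θ.sections ℂ) ^ 2 = Nat.card (B.KTheta Θ))
    {Ω : Type} [Field Ω] [IsAlgClosed Ω] [CharZero Ω] (X : AbelianVariety Ω) (Θ : CartierDivisor X.X.left) (hΘ : Θ.IsAmple) :
    Θ.h0 Ω ^ 2 = Nat.card (X.KTheta Θ) := by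
  classical
  -- §1 the model over the finitely generated field `k₁ := ℚ(s)`
  obtain ⟨s, hs⟩ := exists_finset_intermediateField_descent_end_divisor (F := ℚ) X (J := Fin 0) (fun i => Fin.elim0 i) Θ
  let k₁ : IntermediateField ℚ Ω := IntermediateField.adjoin ℚ (↑s : Set Ω)
  obtain ⟨B₁, ε, -, _, _, Θ₁, -, hΘ₁⟩ := hs k₁ (IntermediateField.subset_adjoin ℚ _)
  haveI : IsIso (Hom.toSchemeHom ε.hom) :=
    ⟨Hom.toSchemeHom ε.inv, by change Hom.toSchemeHom (ε.hom ≫ ε.inv) = _; rw [ε.hom_inv_id]; rfl, by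
      change Hom.toSchemeHom (ε.inv ≫ ε.hom) = _; rw [ε.inv_hom_id]; rfl⟩
  haveI := isDominant_toSchemeHom_iso_hom ε
  let pr₁Ω : (B₁.baseChange Ω).X.left ⟶ B₁.X.left := pullback.fst B₁.X.hom (bcSpec k₁ Ω)
  have hpr₁Ω : pr₁Ω = pullback.fst B₁.X.hom (bcSpec k₁ Ω) := rfl
  have hdomΩ : IsDominant pr₁Ω := by
    change IsDominant (baseChangeHomFst (algebraMap k₁ Ω) B₁.X)
    exact isDominant_baseChangeHomFst_along (algebraMap k₁ Ω) B₁
  haveI := hdomΩ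
  have hΘ₁' : (Θ.pullback (Hom.toSchemeHom ε.hom)).LinEquiv (Θ₁.pullback pr₁Ω) :=
    ((CartierDivisor.classPullback_linEquiv_pullback (Hom.toSchemeHom ε.hom) Θ).symm.trans hΘ₁).trans
      (CartierDivisor.classPullback_linEquiv_pullback pr₁Ω Θ₁)
  have hampΩ : (Θ₁.pullback pr₁Ω).IsAmple := hΘ₁'.isAmple (hΘ.pullback (Hom.toSchemeHom ε.hom))
  have hampΩ' : (Θ₁.classPullback (pullback.fst B₁.X.hom (bcSpec k₁ Ω))).IsAmple :=
    (CartierDivisor.classPullback_linEquiv_pullback pr₁Ω Θ₁).symm.isAmple hampΩ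
  -- §2 spread the ampleness to a finite stage `s′`
  obtain ⟨s', hs'⟩ := CartierDivisor.IsAmple.exists_finset_forall_isAmple_classPullback B₁.X Θ₁ hampΩ'
  -- §3 `K₂ :=` the algebraic closure of `k₁(s′)` in `Ω`: countable, algebraically closed, containing `s′`
  let k₁' : IntermediateField (↥k₁) Ω := IntermediateField.adjoin (↥k₁) (↑s' : Set Ω)
  let K₂ : IntermediateField (↥k₁) Ω := (algebraicClosure (↥k₁') Ω).restrictScalars (↥k₁)
  haveI : IsAlgClosed (↥K₂) := (IsAlgClosure.isAlgClosed (↥k₁') (K := ↥(algebraicClosure (↥k₁') Ω)) :)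
  haveI : CharZero (↥K₂) := (RingHom.charZero_iff (algebraMap (↥K₂) Ω).injective).mpr inferInstance
  haveI : FaithfulSMul (↥k₁') (↥(algebraicClosure (↥k₁') Ω)) :=
    (faithfulSMul_iff_algebraMap_injective _ _).mpr fun x y hxy =>
      Subtype.ext (congrArg (fun z : ↥(algebraicClosure (↥k₁') Ω) => (z : Ω)) hxy)
  haveI : Module.IsTorsionFree (↥k₁') (↥(algebraicClosure (↥k₁') Ω)) := FaithfulSMul.to_isTorsionFree ..
  haveI : Countable (↥K₂) := by
    rw [← Cardinal.mk_le_aleph0_iff]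
    have h₁ : Cardinal.mk (↥k₁) ≤ Cardinal.aleph0 :=
      (IntermediateField.cardinalMk_adjoin_le ℚ (↑s : Set Ω)).trans (by simp)
    have h₂ : Cardinal.mk (↥k₁') ≤ Cardinal.aleph0 :=
      (IntermediateField.cardinalMk_adjoin_le (↥k₁) (↑s' : Set Ω)).trans (by simp [h₁])
    exact (Algebra.IsAlgebraic.cardinalMk_le_max (↥k₁') (↥(algebraicClosure (↥k₁') Ω))).trans (by simp [h₂])
  have hsub : (↑s' : Set Ω) ⊆ Set.range (algebraMap (↥K₂) Ω) := by
    intro x hx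
    have hx₁ : x ∈ k₁' := IntermediateField.subset_adjoin (↥k₁) _ hx
    exact ⟨⟨x, IntermediateField.algebraMap_mem (algebraicClosure (↥k₁') Ω) ⟨x, hx₁⟩⟩, rfl⟩
  have hampK₂ := hs' (↥K₂) hsub
  let B₂ : AbelianVariety (↥K₂) := B₁.baseChange (↥K₂)
  let pr₁₂ : B₂.X.left ⟶ B₁.X.left := pullback.fst B₁.X.hom (bcSpec k₁ (↥K₂))
  have hpr₁₂ : pr₁₂ = pullback.fst B₁.X.hom (bcSpec k₁ (↥K₂)) := rfl
  have hdom₂ : IsDominant pr₁₂ := by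
    change IsDominant (baseChangeHomFst (algebraMap k₁ (↥K₂)) B₁.X)
    exact isDominant_baseChangeHomFst_along (algebraMap k₁ (↥K₂)) B₁
  haveI := hdom₂
  let Θ₂ : CartierDivisor B₂.X.left := Θ₁.pullback pr₁₂
  have hΘ₂ : Θ₂.IsAmple := (CartierDivisor.classPullback_linEquiv_pullback pr₁₂ Θ₁).isAmple hampK₂
  -- the tower `(B₁ ⊗ K₂) ⊗ Ω ≅ B₁ ⊗ Ω` and the projection `pr₂Ω`
  let pr₂Ω : (B₂.baseChange Ω).X.left ⟶ B₂.X.left := pullback.fst B₂.X.hom (bcSpec (↥K₂) Ω)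
  have hpr₂Ω : pr₂Ω = pullback.fst B₂.X.hom (bcSpec (↥K₂) Ω) := rfl
  have hdom₂Ω : IsDominant pr₂Ω := by
    change IsDominant (baseChangeHomFst (algebraMap (↥K₂) Ω) B₂.X)
    exact isDominant_baseChangeHomFst_along (algebraMap (↥K₂) Ω) B₂
  haveI := hdom₂Ω
  let τ : B₂.baseChange Ω ≅ B₁.baseChange Ω := baseChangeTowerIso k₁ (↥K₂) Ω B₁
  haveI := isDominant_toSchemeHom_iso_hom τ
  have sqτ : Hom.toSchemeHom τ.hom ≫ pr₁Ω = pr₂Ω ≫ pr₁₂ := toSchemeHom_baseChangeTowerIso_hom_comp_fst k₁ (↥K₂) Ω B₁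
  haveI : IsDominant (Hom.toSchemeHom τ.hom ≫ pr₁Ω) := inferInstance
  haveI : IsDominant (pr₂Ω ≫ pr₁₂) := inferInstance
  have hτ : ((Θ₁.pullback pr₁Ω).pullback (Hom.toSchemeHom τ.hom)).LinEquiv (Θ₂.pullback pr₂Ω) :=
    (((CartierDivisor.pullback_pullback_sameDivisor Θ₁ pr₁Ω (Hom.toSchemeHom τ.hom)).trans
      (CartierDivisor.pullback_congr_sameDivisor Θ₁ sqτ)).trans
      (CartierDivisor.pullback_pullback_sameDivisor Θ₁ pr₁₂ pr₂Ω).symm).linEquiv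
  -- §4 the embedding `σ : K₂ ↪ ℂ` and the base change `B₂ ⊗_σ ℂ`
  obtain ⟨σ⟩ := Literature.FieldTheory.AlgClosed.nonempty_ringHom_complex_of_countable (↥K₂)
  letI : Algebra (↥K₂) ℂ := σ.toAlgebra
  let prℂ : (B₂.baseChange ℂ).X.left ⟶ B₂.X.left := pullback.fst B₂.X.hom (bcSpec (↥K₂) ℂ)
  have hprℂ : prℂ = pullback.fst B₂.X.hom (bcSpec (↥K₂) ℂ) := rfl
  have hdomℂ : IsDominant prℂ := by
    change IsDominant (baseChangeHomFst (algebraMap (↥K₂) ℂ) B₂.X)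
    exact isDominant_baseChangeHomFst_along (algebraMap (↥K₂) ℂ) B₂
  haveI := hdomℂ
  haveI : IsAffineHom (bcSpec (↥K₂) ℂ) := isAffineHom_of_isAffine _
  haveI : IsAffineHom prℂ := by rw [hprℂ]; exact MorphismProperty.pullback_fst _ _ inferInstance
  have hΘℂ : (Θ₂.pullback prℂ).IsAmple := hΘ₂.pullback prℂ
  -- §5 `h⁰`: Ω → (B₁ ⊗ Ω, ε^*Θ ∼ Θ₁ ⊗ Ω) → k₁ → K₂ → ℂ
  have hh0 : Θ.h0 Ω = (Θ₂.pullback prℂ).h0 ℂ := by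
    rw [← h0_pullback_iso_eq X ε Θ, CartierDivisor.LinEquiv.h0_eq (K := Ω) hΘ₁',
      h0_pullback_baseChangeFst_eq Ω B₁ Θ₁ pr₁Ω hpr₁Ω, ← h0_pullback_baseChangeFst_eq (↥K₂) B₁ Θ₁ pr₁₂ hpr₁₂,
      h0_pullback_baseChangeFst_eq ℂ B₂ Θ₂ prℂ hprℂ]
  -- §6 `#K(Θ)`: Ω → (B₁ ⊗ Ω) → ((B₁ ⊗ K₂) ⊗ Ω) → K₂ → ℂ
  have hK : Nat.card (X.KTheta Θ) = Nat.card ((B₂.baseChange ℂ).KTheta (Θ₂.pullback prℂ)) := by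
    rw [← natCard_KTheta_pullback_iso ε Θ, KTheta_congr_linEquiv _ hΘ₁', ← natCard_KTheta_pullback_iso τ,
      KTheta_congr_linEquiv _ hτ, natCard_KTheta_baseChange_eq Ω B₂ Θ₂ pr₂Ω hpr₂Ω hΘ₂,
      natCard_KTheta_baseChange_eq ℂ B₂ Θ₂ prℂ hprℂ hΘ₂]
  -- §7 the ℂ-brick
  rw [hh0, hK]
  exact hℂ (B₂.baseChange ℂ) (Θ₂.pullback prℂ) hΘℂ

/-- **The same in the `finrank` spelling of the ℂ-brick**: `dim_Ω Γ(A, 𝒪(Θ))² = #K(Θ)`.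
[cite: MumfordAV1970, §16 (the Riemann–Roch theorem)] -/
theorem finrank_sections_sq_eq_natCard_KTheta_of_complex
    (hℂ : ∀ (B : AbelianVariety ℂ) (Θ : CartierDivisor B.X.left), Θ.IsAmple →
      Module.finrank ℂ (Θ.sections ℂ) ^ 2 = Nat.card (B.KTheta Θ))
    {Ω : Type} [Field Ω] [IsAlgClosed Ω] [CharZero Ω] (X : AbelianVariety Ω) (Θ : CartierDivisor X.X.left) (hΘ : Θ.IsAmple) :
    Module.finrank Ω (Θ.sections Ω) ^ 2 = Nat.card (X.KTheta Θ) :=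
  h0_sq_eq_natCard_KTheta_of_complex hℂ X Θ hΘ

/-- **… and in the `SecMod` currency of the cohomology-and-base-change files**: `dim_Ω Γ(A, lineBundle 𝒪(Θ))² = #K(Θ)`.
[cite: MumfordAV1970, §16 (the Riemann–Roch theorem)] -/
theorem finrank_secMod_lineBundle_sq_eq_natCard_KTheta_of_complex
    (hℂ : ∀ (B : AbelianVariety ℂ) (Θ : CartierDivisor B.X.left), Θ.IsAmple →
      Module.finrank ℂ (Θ.sections ℂ) ^ 2 = Nat.card (B.KTheta Θ))
    {Ω : Type} [Field Ω] [IsAlgClosed Ω] [CharZero Ω] (X : AbelianVariety Ω) (Θ : CartierDivisor X.X.left) (hΘ : Θ.IsAmple) :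
    Module.finrank Ω (SecMod (Modules.lineBundle Θ.toUnitCocycle)
        (X.X.hom.appTop.hom.comp (Scheme.ΓSpecIso (.of Ω)).inv.hom) ⊤) ^ 2 = Nat.card (X.KTheta Θ) := by
  rw [CartierDivisor.finrank_secMod_lineBundle_eq_h0 X.X Θ]
  exact h0_sq_eq_natCard_KTheta_of_complex hℂ X Θ hΘ

/-! ## §5 UNCONDITIONAL: the ℂ-brick is ★ (R2) `HodgeTheory/AbelianVarietyH0SqEqCardKTheta.finrank_sections_sq_eq_natCard_KTheta` -/

/-- **`h⁰(A, 𝒪(Θ))² = #K(Θ)` for `Θ` ample on an abelian variety over EVERY algebraically closed field of characteristic `0`** —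
[MumfordAV1970] §16 (the Riemann–Roch theorem `χ(L)² = deg φ_L` with the vanishing theorem `χ(L) = h⁰(L)` for `L` ample), here:
over `ℂ` by theta functions and GAGA (★ (R2) `AbelianVariety.finrank_sections_sq_eq_natCard_KTheta`, B-p05 (g17) over ★ (R1)
`HodgeTheory/GAGASectionsOfLineBundle`, B-p18 (g18)), transported by §4. [cite: MumfordAV1970, §16 (the Riemann–Roch theorem)] -/
theorem h0_sq_eq_natCard_KTheta_of_isAlgClosed {Ω : Type} [Field Ω] [IsAlgClosed Ω] [CharZero Ω] (X : AbelianVariety Ω)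
    (Θ : CartierDivisor X.X.left) (hΘ : Θ.IsAmple) : Θ.h0 Ω ^ 2 = Nat.card (X.KTheta Θ) :=
  h0_sq_eq_natCard_KTheta_of_complex (fun B Θ' h => B.finrank_sections_sq_eq_natCard_KTheta Θ' h) X Θ hΘ

/-- `finrank` spelling: `dim_Ω Γ(A, 𝒪(Θ))² = #K(Θ)`, every algebraically closed `Ω` of characteristic `0`.
[cite: MumfordAV1970, §16 (the Riemann–Roch theorem)] -/
theorem finrank_sections_sq_eq_natCard_KTheta_of_isAlgClosed {Ω : Type} [Field Ω] [IsAlgClosed Ω] [CharZero Ω]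
    (X : AbelianVariety Ω) (Θ : CartierDivisor X.X.left) (hΘ : Θ.IsAmple) :
    Module.finrank Ω (Θ.sections Ω) ^ 2 = Nat.card (X.KTheta Θ) :=
  h0_sq_eq_natCard_KTheta_of_isAlgClosed X Θ hΘ

/-- `SecMod` spelling: `dim_Ω Γ(A, lineBundle 𝒪(Θ))² = #K(Θ)`, every algebraically closed `Ω` of characteristic `0`.
[cite: MumfordAV1970, §16 (the Riemann–Roch theorem)] -/
theorem finrank_secMod_lineBundle_sq_eq_natCard_KTheta_of_isAlgClosed {Ω : Type} [Field Ω] [IsAlgClosed Ω] [CharZero Ω]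
    (X : AbelianVariety Ω) (Θ : CartierDivisor X.X.left) (hΘ : Θ.IsAmple) :
    Module.finrank Ω (SecMod (Modules.lineBundle Θ.toUnitCocycle)
        (X.X.hom.appTop.hom.comp (Scheme.ΓSpecIso (.of Ω)).inv.hom) ⊤) ^ 2 = Nat.card (X.KTheta Θ) :=
  finrank_secMod_lineBundle_sq_eq_natCard_KTheta_of_complex (fun B Θ' h => B.finrank_sections_sq_eq_natCard_KTheta Θ' h) X Θ hΘ

end AbelianVariety

end Literature.AlgebraicGeometry.Motives
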